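import Mathlib
import HarnessLib
import Summits.Ventures.LatticeQCDFlow.Exactness.SU2WilsonFlowLOTranslation
import Summits.Ventures.LatticeQCDFlow.Exactness.U1FTHMCTranslationCovariance

/-!
# `U(1)` rung: the parity-masked LO Wilson-flow member is translation equivariant under mask-preserving translations, the exact force of a translation-invariant action is translation covariant, and the `U(1)` FT-HMC kernel through the LO member commutes with every even translation

HONEST FRAMING: exact (Metropolis-corrected) sampling algorithms for lattice gauge theory;
figures of merit are autocorrelation/cost numbers at stated couplings and volumes; no
continuum-physics claim.

Venture `LatticeQCDFlow` (cell pub-lqcd), topic `Exactness`; FANOUT row 14 (`eng-flowhmc`, `U(1)`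
rung: links `GaugeConfig d L U(1)`, momenta `Edge d L → ℝ`, drift `V_e ← e^{icp_e} V_e`; member
`maps.u1_wilson_flow_lo`).  NEW WORK of the cell; nothing is cited as a fact; no number.  The abelian
twin of `SU2WilsonFlowLOTranslation` + `SU2ExactForceTranslationCovariance`, closing both items of
the NOT-CLAIMED list of GEN-10's `U1FTHMCTranslationCovariance`:

* **`u1WilsonFlowLOSubstep_translate`**, **`u1WilsonFlowLOJacobian_translate`**,
  **`u1WilsonFlowLO_member_translate`** — the masked `U(1)` Wilson-flow sub-step
  `V(x,μ) ↦ V(x,μ) e^{iεZ}` (formulas VERBATIM as in `exists_layers_u1WilsonFlowLO`) is translation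
  equivariant, its booked density `∏_active (1 − εC)` translation invariant, for every translation
  `t` preserving the colouring (`χ (x + t) = χ x`); hence so is ANY schedule packaged as in
  `exists_layers_u1WilsonFlowLO` (composite equivariant, running log-det invariant);
* `circleDrift_translate_mul`, `u1ftAction_drift_translate`, `u1single_translate`,
  **`u1ExactForce_translate`** — the exact force `g_κ V (e) = κ · fderiv ℝ (p ↦ S̃(e^{icp}·V)) 0 (e_e)`
  of every translation-invariant `S̃` is translation covariant (chain rule through the coordinate
  permutation, a continuous linear equivalence; no differentiability hypothesis);
  **`u1_fthmc_exactForce_conjKernel_translate`** — the `U(1)` FT-HMC kernel with the exact-gradient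
  force commutes with every translation (equivariant `F`, invariant measurable `J`, `S`, continuous
  `S̃`): no force hypothesis;
* **`u1_fthmc_wilsonFlowLO_translationCovariant`** — for a proper colouring, `2(d−1)|ε| < 1` and
  ANY schedule: the packaged LO member, and for every mask-preserving `t`, every translation-invariant
  measurable `S` and translation-covariant measurable force routine, `conjKernel K Θ_t = K`;
  **`u1_fthmc_wilsonFlowLO_exactForce_translationCovariant`** — the same with the exact-gradient
  force (continuity of `S̃` as the one remaining certificate).

NOT CLAIMED: translations permuting the colour classes; continuity of the `U(1)` member's `S̃`
(not typed on this rung); any number.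
-/

noncomputable section

namespace Summit.Ventures.LatticeQCDFlow.Exactness

open Set MeasureTheory
open ProbabilityTheory ProbabilityTheory.Kernel
open Literature.MathematicalPhysics.QuantumFieldTheory
open scoped ENNReal

variable {d L : ℕ}

/-! ## The exact force under translations (`U(1)` rung) -/

section ExactForce

/-- `e^{icp} · (V·t) = ((e^{ic (p·(−t))}) · V)·t` — the drift seen from translated data. -/
theorem circleDrift_translate_mul (t : Site d L) (c : ℝ) (p : (Edge d L → ℝ)) (V : GaugeConfig d L Circle) :
    (fun i : Edge d L => Circle.exp (c * p i)) * (fun e : Edge d L => V (e.1 + t, e.2)) =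
      (fun e : Edge d L => (((fun i : Edge d L => Circle.exp (c * (fun j : Edge d L => p (j.1 - t, j.2)) i)) * V : GaugeConfig d L Circle) (e.1 + t, e.2))) := by
  funext e
  simp only [Pi.mul_apply, add_sub_cancel_right, Prod.mk.eta]

/-- For a translation-invariant `S̃`, the action along the drift from `V·t` is the action along the
drift from `V` precomposed with the momentum re-indexing `p ↦ p·(−t)`. -/
theorem u1ftAction_drift_translate (t : Site d L) {St : GaugeConfig d L Circle → ℝ}
    (hSt : ∀ V : GaugeConfig d L Circle, St (fun e : Edge d L => V (e.1 + t, e.2)) = St V) (c : ℝ) (V : GaugeConfig d L Circle) :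
    (fun p : (Edge d L → ℝ) => St ((fun i : Edge d L => Circle.exp (c * p i)) * (fun e : Edge d L => V (e.1 + t, e.2)))) =
      (fun p : (Edge d L → ℝ) => St ((fun i : Edge d L => Circle.exp (c * p i)) * V)) ∘ (fun p : (Edge d L → ℝ) => (fun j : Edge d L => p (j.1 - t, j.2))) := by
  funext p
  rw [Function.comp_apply, circleDrift_translate_mul t c p V]
  exact hSt _

/-- The momentum re-indexing sends the coordinate vector `e_q` to `e_(q + t)`. -/
theorem u1single_translate (t : Site d L) (q : Edge d L) :
    (fun j : Edge d L => (Pi.single q (1 : ℝ) : (Edge d L → ℝ)) (j.1 - t, j.2)) =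
      (Pi.single (q.1 + t, q.2) (1 : ℝ) : (Edge d L → ℝ)) := by
  funext j
  by_cases h : j = (q.1 + t, q.2)
  · subst h
    simp only [add_sub_cancel_right, Prod.mk.eta, Pi.single_eq_same]
  · rw [Pi.single_eq_of_ne h, Pi.single_eq_of_ne]
    intro h'
    apply h
    obtain ⟨x, μ⟩ := j
    obtain ⟨y, ν⟩ := q
    simp only [Prod.mk.injEq] at h' ⊢
    obtain ⟨hx, hμ⟩ := h'
    exact ⟨by rw [← hx, sub_add_cancel], hμ⟩

variable [NeZero L]

/-- **The exact force of a translation-invariant action is translation covariant (`U(1)` rung)**: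
`g_κ (V·t) = (g_κ V)·t` for `g_κ V (e) = κ · fderiv ℝ (p ↦ S̃(e^{icp} · V)) 0 (Pi.single e 1)`. -/
theorem u1ExactForce_translate (t : Site d L) {St : GaugeConfig d L Circle → ℝ}
    (hSt : ∀ V : GaugeConfig d L Circle, St (fun e : Edge d L => V (e.1 + t, e.2)) = St V) (c κ : ℝ) (V : GaugeConfig d L Circle) :
    (fun i : Edge d L => κ * fderiv ℝ (fun p : (Edge d L → ℝ) => St ((fun i : Edge d L => Circle.exp (c * p i)) * (fun e : Edge d L => V (e.1 + t, e.2)))) 0 (Pi.single i 1)) =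
      (fun e : Edge d L => (fun i : Edge d L => κ * fderiv ℝ (fun p : (Edge d L → ℝ) => St ((fun i : Edge d L => Circle.exp (c * p i)) * V)) 0 (Pi.single i 1)) (e.1 + t, e.2)) := by
  let Le : (Edge d L → ℝ) ≃ₗ[ℝ] (Edge d L → ℝ) :=
    { toFun := fun p => (fun j : Edge d L => p (j.1 - t, j.2)),
      invFun := fun p => (fun j : Edge d L => p (j.1 + t, j.2)),
      map_add' := fun p p' => rfl,
      map_smul' := fun r p => rfl,
      left_inv := fun p => funext fun j => by simp only [add_sub_cancel_right, Prod.mk.eta],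
      right_inv := fun p => funext fun j => by simp only [sub_add_cancel, Prod.mk.eta] }
  let Lc : (Edge d L → ℝ) ≃L[ℝ] (Edge d L → ℝ) := Le.toContinuousLinearEquiv
  have hLc : ∀ p : (Edge d L → ℝ), Lc p = (fun j : Edge d L => p (j.1 - t, j.2)) := fun p => rfl
  have hcomp : (fun p : (Edge d L → ℝ) => St ((fun i : Edge d L => Circle.exp (c * p i)) * (fun e : Edge d L => V (e.1 + t, e.2)))) =
      (fun p : (Edge d L → ℝ) => St ((fun i : Edge d L => Circle.exp (c * p i)) * V)) ∘ (⇑Lc) := by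
    rw [u1ftAction_drift_translate t hSt c V]
    rfl
  funext q
  beta_reduce
  rw [hcomp, Lc.comp_right_fderiv, ContinuousLinearEquiv.map_zero, ContinuousLinearMap.comp_apply]
  change κ * fderiv ℝ (fun p : (Edge d L → ℝ) => St ((fun i : Edge d L => Circle.exp (c * p i)) * V)) 0 (Lc (Pi.single q 1)) = _
  rw [hLc, u1single_translate t q]

/-- **The `U(1)` FT-HMC kernel with the exact-gradient force of `S̃ = S∘F − log J` commutes with every
lattice translation** (translation-equivariant member, translation-invariant measurable `J`, `S`,
continuous `S̃`; any `c`, `κ`, `n`) — no force hypothesis left. -/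
theorem u1_fthmc_exactForce_conjKernel_translate (t : Site d L)
    (F : GaugeConfig d L Circle ≃ᵐ GaugeConfig d L Circle) (hF : ∀ V : GaugeConfig d L Circle, F (fun e : Edge d L => V (e.1 + t, e.2)) = (fun e : Edge d L => (F V) (e.1 + t, e.2)))
    {J : GaugeConfig d L Circle → ℝ} (hJm : Measurable J) (hJ : ∀ V : GaugeConfig d L Circle, J (fun e : Edge d L => V (e.1 + t, e.2)) = J V)
    {S : GaugeConfig d L Circle → ℝ} (hS : Measurable S) (hSi : ∀ V : GaugeConfig d L Circle, S (fun e : Edge d L => V (e.1 + t, e.2)) = S V)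
    (hSc : Continuous fun W : GaugeConfig d L Circle => S (F W) - Real.log (J W)) (c κ : ℝ) (n : ℕ) :
    conjKernel
      (conjKernel
        (refreshUpdate
          (involMH
            (⇑((flip : Equiv.Perm (GaugeConfig d L Circle × (Edge d L → ℝ))) *
                leapfrog (mulDrift (fun p : Edge d L → ℝ => fun i : Edge d L => Circle.exp (c * p i))) (fun V : GaugeConfig d L Circle => (fun i : Edge d L => κ * fderiv ℝ (fun p : (Edge d L → ℝ) => (fun W : GaugeConfig d L Circle => S (F W) - Real.log (J W)) ((fun i : Edge d L => Circle.exp (c * p i)) * V)) 0 (Pi.single i 1))) ^ n))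
            (measurable_flip_leapfrog_pow (measurable_mulDrift (measurable_circleDrift c)) (measurable_u1ExactForce hSc c κ) n)
            fun z : GaugeConfig d L Circle × (Edge d L → ℝ) =>
              (S (F z.1) - Real.log (J z.1)) + ∑ i, z.2 i ^ 2 / 2)
          ((((volume : Measure (Edge d L → ℝ)).withDensity
                  fun p => ENNReal.ofReal (Real.exp (-(∑ i, p i ^ 2 / 2)))) Set.univ)⁻¹ •
              (volume : Measure (Edge d L → ℝ)).withDensity
                fun p => ENNReal.ofReal (Real.exp (-(∑ i, p i ^ 2 / 2)))))
        F)
      ({ toFun := fun V : GaugeConfig d L Circle => (fun e : Edge d L => V (e.1 + t, e.2)),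
         invFun := fun V : GaugeConfig d L Circle => (fun e : Edge d L => V (e.1 - t, e.2)),
         left_inv := fun V => funext fun e => by simp only [sub_add_cancel],
         right_inv := fun V => funext fun e => by simp only [add_sub_cancel_right],
         measurable_toFun := measurable_pi_lambda _ fun e => measurable_pi_apply _,
         measurable_invFun := measurable_pi_lambda _ fun e => measurable_pi_apply _ } : GaugeConfig d L Circle ≃ᵐ GaugeConfig d L Circle) =
      (conjKernel
        (refreshUpdate
          (involMH
            (⇑((flip : Equiv.Perm (GaugeConfig d L Circle × (Edge d L → ℝ))) *
                leapfrog (mulDrift (fun p : Edge d L → ℝ => fun i : Edge d L => Circle.exp (c * p i))) (fun V : GaugeConfig d L Circle => (fun i : Edge d L => κ * fderiv ℝ (fun p : (Edge d L → ℝ) => (fun W : GaugeConfig d L Circle => S (F W) - Real.log (J W)) ((fun i : Edge d L => Circle.exp (c * p i)) * V)) 0 (Pi.single i 1))) ^ n))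
            (measurable_flip_leapfrog_pow (measurable_mulDrift (measurable_circleDrift c)) (measurable_u1ExactForce hSc c κ) n)
            fun z : GaugeConfig d L Circle × (Edge d L → ℝ) =>
              (S (F z.1) - Real.log (J z.1)) + ∑ i, z.2 i ^ 2 / 2)
          ((((volume : Measure (Edge d L → ℝ)).withDensity
                  fun p => ENNReal.ofReal (Real.exp (-(∑ i, p i ^ 2 / 2)))) Set.univ)⁻¹ •
              (volume : Measure (Edge d L → ℝ)).withDensity
                fun p => ENNReal.ofReal (Real.exp (-(∑ i, p i ^ 2 / 2)))))
        F) := by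
  have hSt : ∀ V : GaugeConfig d L Circle, (fun W : GaugeConfig d L Circle => S (F W) - Real.log (J W)) (fun e : Edge d L => V (e.1 + t, e.2)) =
      (fun W : GaugeConfig d L Circle => S (F W) - Real.log (J W)) V := fun V => by
    beta_reduce
    rw [hF V, hSi, hJ V]
  exact u1_fthmc_conjKernel_translate t F hF hJm hJ hS hSi c (measurable_u1ExactForce hSc c κ)
    (fun V => u1ExactForce_translate t (St := fun W : GaugeConfig d L Circle => S (F W) - Real.log (J W)) hSt c κ V) n

end ExactForce

/-! ## The `U(1)` LO member under mask-preserving translations -/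

section Member

variable {X : Type*} [DecidableEq X] (χ : Site d L → X)

/-- **The masked `U(1)` Wilson-flow sub-step is translation equivariant** under every translation `t`
preserving the colouring: `F(V·t) = (F V)·t` (formulas VERBATIM as in `exists_layers_u1WilsonFlowLO`). -/
theorem u1WilsonFlowLOSubstep_translate (t : Site d L) (hχ : ∀ x : Site d L, χ (x + t) = χ x)
    (μ : Fin d) (b : X) (ε : ℝ) (V : GaugeConfig d L Circle) :
    (fun (V : GaugeConfig d L Circle) (e : Edge d L) => if e.2 = μ ∧ χ e.1 = b then
          V e * Circle.exp (ε * ∑ ν ∈ Finset.univ.erase e.2,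
            (((plaquetteHolonomy V (e.1 - Pi.single ν 1) e.2 ν : Circle) : ℂ).im -
              ((plaquetteHolonomy V e.1 e.2 ν : Circle) : ℂ).im)) else V e) (fun e : Edge d L => V (e.1 + t, e.2)) =
      fun e : Edge d L => ((fun (V : GaugeConfig d L Circle) (e : Edge d L) => if e.2 = μ ∧ χ e.1 = b then
          V e * Circle.exp (ε * ∑ ν ∈ Finset.univ.erase e.2,
            (((plaquetteHolonomy V (e.1 - Pi.single ν 1) e.2 ν : Circle) : ℂ).im -
              ((plaquetteHolonomy V e.1 e.2 ν : Circle) : ℂ).im)) else V e) V) (e.1 + t, e.2) := by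
  have hsub : ∀ (y : Site d L) (ν : Fin d), y - Pi.single ν 1 + t = y + t - Pi.single ν 1 :=
    fun y ν => sub_add_eq_add_sub y (Pi.single ν 1) t
  funext e
  simp only [plaquetteHolonomy_translate, hsub, hχ]

variable [NeZero L]

/-- **The booked density of the masked `U(1)` sub-step is translation invariant** under every
translation preserving the colouring (re-index the active class). -/
theorem u1WilsonFlowLOJacobian_translate (t : Site d L) (hχ : ∀ x : Site d L, χ (x + t) = χ x)
    (μ : Fin d) (b : X) (ε : ℝ) (V : GaugeConfig d L Circle) :
    (fun V : GaugeConfig d L Circle => ∏ a : {e : Edge d L // e.2 = μ ∧ χ e.1 = b},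
          (1 - ε * ∑ ν ∈ Finset.univ.erase a.1.2,
            (((plaquetteHolonomy V a.1.1 a.1.2 ν : Circle) : ℂ).re +
              ((plaquetteHolonomy V (a.1.1 - Pi.single ν 1) a.1.2 ν : Circle) : ℂ).re))) (fun e : Edge d L => V (e.1 + t, e.2)) =
      (fun V : GaugeConfig d L Circle => ∏ a : {e : Edge d L // e.2 = μ ∧ χ e.1 = b},
          (1 - ε * ∑ ν ∈ Finset.univ.erase a.1.2,
            (((plaquetteHolonomy V a.1.1 a.1.2 ν : Circle) : ℂ).re +
              ((plaquetteHolonomy V (a.1.1 - Pi.single ν 1) a.1.2 ν : Circle) : ℂ).re))) V := by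
  have hsub : ∀ (y : Site d L) (ν : Fin d), y - Pi.single ν 1 + t = y + t - Pi.single ν 1 :=
    fun y ν => sub_add_eq_add_sub y (Pi.single ν 1) t
  have hfwd : ∀ a : {e : Edge d L // e.2 = μ ∧ χ e.1 = b}, (a.1.1 + t, a.1.2).2 = μ ∧ χ (a.1.1 + t, a.1.2).1 = b :=
    fun a => ⟨a.2.1, (hχ a.1.1).trans a.2.2⟩
  have hbwd : ∀ a : {e : Edge d L // e.2 = μ ∧ χ e.1 = b}, (a.1.1 - t, a.1.2).2 = μ ∧ χ (a.1.1 - t, a.1.2).1 = b := by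
    intro a
    refine ⟨a.2.1, ?_⟩
    have h := hχ (a.1.1 - t)
    rw [sub_add_cancel] at h
    exact h ▸ a.2.2
  let τ : {e : Edge d L // e.2 = μ ∧ χ e.1 = b} ≃ {e : Edge d L // e.2 = μ ∧ χ e.1 = b} :=
    { toFun := fun a => ⟨(a.1.1 + t, a.1.2), hfwd a⟩,
      invFun := fun a => ⟨(a.1.1 - t, a.1.2), hbwd a⟩,
      left_inv := fun a => Subtype.ext (Prod.ext (add_sub_cancel_right a.1.1 t) rfl),
      right_inv := fun a => Subtype.ext (Prod.ext (sub_add_cancel a.1.1 t) rfl) }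
  simp only [plaquetteHolonomy_translate, hsub]
  exact Fintype.prod_equiv τ _ _ (fun a => rfl)

/-- **The `U(1)` LO Wilson-flow member is translation equivariant with a translation-invariant running
log-det** under every translation preserving the colouring — for ANY `layers` packaged as in
`exists_layers_u1WilsonFlowLO` (the hypotheses `hF`, `hJ` of `u1_fthmc_conjKernel_translate`). -/
theorem u1WilsonFlowLO_member_translate (t : Site d L) (hχ : ∀ x : Site d L, χ (x + t) = χ x)
    (ε : ℝ) (sched : List (Fin d × X)) (layers : List ((GaugeConfig d L Circle ≃ᵐ GaugeConfig d L Circle) × (GaugeConfig d L Circle → ℝ)))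
    (hmap :
      layers.map (fun Ly => ((Ly.1 : GaugeConfig d L Circle → GaugeConfig d L Circle), Ly.2)) = sched.map (fun s =>
        ((fun (V : GaugeConfig d L Circle) (e : Edge d L) => if e.2 = s.1 ∧ χ e.1 = s.2 then
          V e * Circle.exp (ε * ∑ ν ∈ Finset.univ.erase e.2,
            (((plaquetteHolonomy V (e.1 - Pi.single ν 1) e.2 ν : Circle) : ℂ).im -
              ((plaquetteHolonomy V e.1 e.2 ν : Circle) : ℂ).im)) else V e),
         fun V : GaugeConfig d L Circle => ∏ a : {e : Edge d L // e.2 = s.1 ∧ χ e.1 = s.2},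
          (1 - ε * ∑ ν ∈ Finset.univ.erase a.1.2,
            (((plaquetteHolonomy V a.1.1 a.1.2 ν : Circle) : ℂ).re +
              ((plaquetteHolonomy V (a.1.1 - Pi.single ν 1) a.1.2 ν : Circle) : ℂ).re))))) :
    (∀ V : GaugeConfig d L Circle, (layers.foldr (fun Ly (F : GaugeConfig d L Circle ≃ᵐ GaugeConfig d L Circle) => Ly.1.trans F) (MeasurableEquiv.refl (GaugeConfig d L Circle))) (fun e : Edge d L => V (e.1 + t, e.2)) =
        fun e : Edge d L => ((layers.foldr (fun Ly (F : GaugeConfig d L Circle ≃ᵐ GaugeConfig d L Circle) => Ly.1.trans F) (MeasurableEquiv.refl (GaugeConfig d L Circle))) V) (e.1 + t, e.2)) ∧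
    (∀ V : GaugeConfig d L Circle, (layers.foldr (fun Ly K => fun v => Ly.2 v * K (Ly.1 v)) (fun _ => (1 : ℝ))) (fun e : Edge d L => V (e.1 + t, e.2)) = (layers.foldr (fun Ly K => fun v => Ly.2 v * K (Ly.1 v)) (fun _ => (1 : ℝ))) V) := by
  have key := comm_of_layers_map_eq (fun V : GaugeConfig d L Circle => (fun e : Edge d L => V (e.1 + t, e.2))) layers sched
    (fun s => (fun (V : GaugeConfig d L Circle) (e : Edge d L) => if e.2 = s.1 ∧ χ e.1 = s.2 then
          V e * Circle.exp (ε * ∑ ν ∈ Finset.univ.erase e.2,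
            (((plaquetteHolonomy V (e.1 - Pi.single ν 1) e.2 ν : Circle) : ℂ).im -
              ((plaquetteHolonomy V e.1 e.2 ν : Circle) : ℂ).im)) else V e))
    (fun s => fun V : GaugeConfig d L Circle => ∏ a : {e : Edge d L // e.2 = s.1 ∧ χ e.1 = s.2},
          (1 - ε * ∑ ν ∈ Finset.univ.erase a.1.2,
            (((plaquetteHolonomy V a.1.1 a.1.2 ν : Circle) : ℂ).re +
              ((plaquetteHolonomy V (a.1.1 - Pi.single ν 1) a.1.2 ν : Circle) : ℂ).re)))
    hmap
    (fun s _ V => by beta_reduce; exact u1WilsonFlowLOSubstep_translate χ t hχ s.1 s.2 ε V)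
    (fun s _ V => u1WilsonFlowLOJacobian_translate χ t hχ s.1 s.2 ε V)
  exact ⟨fun V => foldr_trans_comm _ layers key.1 V, fun V => foldr_logDet_invariant _ layers key.1 key.2 V⟩

/-- **`U(1)` FT-HMC through the engine's LO Wilson-flow member (proper colouring, `2(d−1)|ε| < 1`,
ANY schedule, formulas VERBATIM) commutes with every mask-preserving translation** — invariant
measurable `S`, covariant measurable force routine, any `c`, `n`. -/
theorem u1_fthmc_wilsonFlowLO_translationCovariant
    (hχ : ∀ (x : Site d L) (i : Fin d), χ (x.shift i) ≠ χ x) {ε : ℝ}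
    (hε : |ε| * (2 * ((d - 1 : ℕ) : ℝ)) < 1) (sched : List (Fin d × X)) :
    ∃ layers : List ((GaugeConfig d L Circle ≃ᵐ GaugeConfig d L Circle) × (GaugeConfig d L Circle → ℝ)),
      layers.map (fun Ly => ((Ly.1 : GaugeConfig d L Circle → GaugeConfig d L Circle), Ly.2)) = sched.map (fun s =>
        ((fun (V : GaugeConfig d L Circle) (e : Edge d L) => if e.2 = s.1 ∧ χ e.1 = s.2 then
          V e * Circle.exp (ε * ∑ ν ∈ Finset.univ.erase e.2,
            (((plaquetteHolonomy V (e.1 - Pi.single ν 1) e.2 ν : Circle) : ℂ).im -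
              ((plaquetteHolonomy V e.1 e.2 ν : Circle) : ℂ).im)) else V e),
         fun V : GaugeConfig d L Circle => ∏ a : {e : Edge d L // e.2 = s.1 ∧ χ e.1 = s.2},
          (1 - ε * ∑ ν ∈ Finset.univ.erase a.1.2,
            (((plaquetteHolonomy V a.1.1 a.1.2 ν : Circle) : ℂ).re +
              ((plaquetteHolonomy V (a.1.1 - Pi.single ν 1) a.1.2 ν : Circle) : ℂ).re)))) ∧
      (∀ (t : Site d L), (∀ x : Site d L, χ (x + t) = χ x) →
        (∀ V : GaugeConfig d L Circle, (layers.foldr (fun Ly (F : GaugeConfig d L Circle ≃ᵐ GaugeConfig d L Circle) => Ly.1.trans F) (MeasurableEquiv.refl (GaugeConfig d L Circle))) (fun e : Edge d L => V (e.1 + t, e.2)) =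
            fun e : Edge d L => ((layers.foldr (fun Ly (F : GaugeConfig d L Circle ≃ᵐ GaugeConfig d L Circle) => Ly.1.trans F) (MeasurableEquiv.refl (GaugeConfig d L Circle))) V) (e.1 + t, e.2)) ∧
        (∀ V : GaugeConfig d L Circle, (layers.foldr (fun Ly K => fun v => Ly.2 v * K (Ly.1 v)) (fun _ => (1 : ℝ))) (fun e : Edge d L => V (e.1 + t, e.2)) = (layers.foldr (fun Ly K => fun v => Ly.2 v * K (Ly.1 v)) (fun _ => (1 : ℝ))) V)) ∧
      ∀ (t : Site d L) (_ht : ∀ x : Site d L, χ (x + t) = χ x) {S : GaugeConfig d L Circle → ℝ} (hS : Measurable S)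
        (_hSi : ∀ V : GaugeConfig d L Circle, S (fun e : Edge d L => V (e.1 + t, e.2)) = S V) (c : ℝ)
        {g : GaugeConfig d L Circle → (Edge d L → ℝ)} (hg : Measurable g)
        (_hgc : ∀ V : GaugeConfig d L Circle, g (fun e : Edge d L => V (e.1 + t, e.2)) = (fun e : Edge d L => (g V) (e.1 + t, e.2))) (n : ℕ),
    conjKernel
      (conjKernel
        (refreshUpdate
          (involMH
            (⇑((flip : Equiv.Perm (GaugeConfig d L Circle × (Edge d L → ℝ))) *
                leapfrog (mulDrift (fun p : Edge d L → ℝ => fun i : Edge d L => Circle.exp (c * p i))) g ^ n))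
            (measurable_flip_leapfrog_pow (measurable_mulDrift (measurable_circleDrift c)) hg n)
            fun z : GaugeConfig d L Circle × (Edge d L → ℝ) =>
              (S ((layers.foldr (fun Ly (F : GaugeConfig d L Circle ≃ᵐ GaugeConfig d L Circle) => Ly.1.trans F) (MeasurableEquiv.refl (GaugeConfig d L Circle))) z.1) - Real.log ((layers.foldr (fun Ly K => fun v => Ly.2 v * K (Ly.1 v)) (fun _ => (1 : ℝ))) z.1)) + ∑ i, z.2 i ^ 2 / 2)
          ((((volume : Measure (Edge d L → ℝ)).withDensity
                  fun p => ENNReal.ofReal (Real.exp (-(∑ i, p i ^ 2 / 2)))) Set.univ)⁻¹ •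
              (volume : Measure (Edge d L → ℝ)).withDensity
                fun p => ENNReal.ofReal (Real.exp (-(∑ i, p i ^ 2 / 2)))))
        (layers.foldr (fun Ly (F : GaugeConfig d L Circle ≃ᵐ GaugeConfig d L Circle) => Ly.1.trans F) (MeasurableEquiv.refl (GaugeConfig d L Circle))))
      ({ toFun := fun V : GaugeConfig d L Circle => (fun e : Edge d L => V (e.1 + t, e.2)),
         invFun := fun V : GaugeConfig d L Circle => (fun e : Edge d L => V (e.1 - t, e.2)),
         left_inv := fun V => funext fun e => by simp only [sub_add_cancel],
         right_inv := fun V => funext fun e => by simp only [add_sub_cancel_right],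
         measurable_toFun := measurable_pi_lambda _ fun e => measurable_pi_apply _,
         measurable_invFun := measurable_pi_lambda _ fun e => measurable_pi_apply _ } : GaugeConfig d L Circle ≃ᵐ GaugeConfig d L Circle) =
      (conjKernel
        (refreshUpdate
          (involMH
            (⇑((flip : Equiv.Perm (GaugeConfig d L Circle × (Edge d L → ℝ))) *
                leapfrog (mulDrift (fun p : Edge d L → ℝ => fun i : Edge d L => Circle.exp (c * p i))) g ^ n))
            (measurable_flip_leapfrog_pow (measurable_mulDrift (measurable_circleDrift c)) hg n)
            fun z : GaugeConfig d L Circle × (Edge d L → ℝ) =>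
              (S ((layers.foldr (fun Ly (F : GaugeConfig d L Circle ≃ᵐ GaugeConfig d L Circle) => Ly.1.trans F) (MeasurableEquiv.refl (GaugeConfig d L Circle))) z.1) - Real.log ((layers.foldr (fun Ly K => fun v => Ly.2 v * K (Ly.1 v)) (fun _ => (1 : ℝ))) z.1)) + ∑ i, z.2 i ^ 2 / 2)
          ((((volume : Measure (Edge d L → ℝ)).withDensity
                  fun p => ENNReal.ofReal (Real.exp (-(∑ i, p i ^ 2 / 2)))) Set.univ)⁻¹ •
              (volume : Measure (Edge d L → ℝ)).withDensity
                fun p => ENNReal.ofReal (Real.exp (-(∑ i, p i ^ 2 / 2)))))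
        (layers.foldr (fun Ly (F : GaugeConfig d L Circle ≃ᵐ GaugeConfig d L Circle) => Ly.1.trans F) (MeasurableEquiv.refl (GaugeConfig d L Circle)))) := by
  obtain ⟨layers, hmap, -, hmeas, -⟩ := exists_layers_u1WilsonFlowLO χ hχ hε sched
  refine ⟨layers, hmap, ?_, ?_⟩
  · intro t ht
    exact u1WilsonFlowLO_member_translate χ t ht ε sched layers hmap
  · intro t ht S hS hSi c g hg hgc n
    have hm := u1WilsonFlowLO_member_translate χ t ht ε sched layers hmap
    exact u1_fthmc_conjKernel_translate t _ hm.1 (measurable_foldr_logDet layers hmeas) hm.2 hS hSi c hg hgc n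

/-- **The same with the EXACT-gradient force of `S̃ = S∘F − log J`** — invariant measurable `S`,
`S̃` continuous, any `c`, `κ`, `n`: no force hypothesis. -/
theorem u1_fthmc_wilsonFlowLO_exactForce_translationCovariant
    (hχ : ∀ (x : Site d L) (i : Fin d), χ (x.shift i) ≠ χ x) {ε : ℝ}
    (hε : |ε| * (2 * ((d - 1 : ℕ) : ℝ)) < 1) (sched : List (Fin d × X)) :
    ∃ layers : List ((GaugeConfig d L Circle ≃ᵐ GaugeConfig d L Circle) × (GaugeConfig d L Circle → ℝ)),
      layers.map (fun Ly => ((Ly.1 : GaugeConfig d L Circle → GaugeConfig d L Circle), Ly.2)) = sched.map (fun s =>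
        ((fun (V : GaugeConfig d L Circle) (e : Edge d L) => if e.2 = s.1 ∧ χ e.1 = s.2 then
          V e * Circle.exp (ε * ∑ ν ∈ Finset.univ.erase e.2,
            (((plaquetteHolonomy V (e.1 - Pi.single ν 1) e.2 ν : Circle) : ℂ).im -
              ((plaquetteHolonomy V e.1 e.2 ν : Circle) : ℂ).im)) else V e),
         fun V : GaugeConfig d L Circle => ∏ a : {e : Edge d L // e.2 = s.1 ∧ χ e.1 = s.2},
          (1 - ε * ∑ ν ∈ Finset.univ.erase a.1.2,
            (((plaquetteHolonomy V a.1.1 a.1.2 ν : Circle) : ℂ).re +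
              ((plaquetteHolonomy V (a.1.1 - Pi.single ν 1) a.1.2 ν : Circle) : ℂ).re)))) ∧
      ∀ (t : Site d L) (_ht : ∀ x : Site d L, χ (x + t) = χ x) {S : GaugeConfig d L Circle → ℝ} (hS : Measurable S)
        (_hSi : ∀ V : GaugeConfig d L Circle, S (fun e : Edge d L => V (e.1 + t, e.2)) = S V)
        (hSc : Continuous fun W : GaugeConfig d L Circle => S ((layers.foldr (fun Ly (F : GaugeConfig d L Circle ≃ᵐ GaugeConfig d L Circle) => Ly.1.trans F) (MeasurableEquiv.refl (GaugeConfig d L Circle))) W) - Real.log ((layers.foldr (fun Ly K => fun v => Ly.2 v * K (Ly.1 v)) (fun _ => (1 : ℝ))) W)) (c κ : ℝ) (n : ℕ),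
    conjKernel
      (conjKernel
        (refreshUpdate
          (involMH
            (⇑((flip : Equiv.Perm (GaugeConfig d L Circle × (Edge d L → ℝ))) *
                leapfrog (mulDrift (fun p : Edge d L → ℝ => fun i : Edge d L => Circle.exp (c * p i))) (fun V : GaugeConfig d L Circle => (fun i : Edge d L => κ * fderiv ℝ (fun p : (Edge d L → ℝ) => (fun W : GaugeConfig d L Circle => S ((layers.foldr (fun Ly (F : GaugeConfig d L Circle ≃ᵐ GaugeConfig d L Circle) => Ly.1.trans F) (MeasurableEquiv.refl (GaugeConfig d L Circle))) W) - Real.log ((layers.foldr (fun Ly K => fun v => Ly.2 v * K (Ly.1 v)) (fun _ => (1 : ℝ))) W)) ((fun i : Edge d L => Circle.exp (c * p i)) * V)) 0 (Pi.single i 1))) ^ n))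
            (measurable_flip_leapfrog_pow (measurable_mulDrift (measurable_circleDrift c)) (measurable_u1ExactForce hSc c κ) n)
            fun z : GaugeConfig d L Circle × (Edge d L → ℝ) =>
              (S ((layers.foldr (fun Ly (F : GaugeConfig d L Circle ≃ᵐ GaugeConfig d L Circle) => Ly.1.trans F) (MeasurableEquiv.refl (GaugeConfig d L Circle))) z.1) - Real.log ((layers.foldr (fun Ly K => fun v => Ly.2 v * K (Ly.1 v)) (fun _ => (1 : ℝ))) z.1)) + ∑ i, z.2 i ^ 2 / 2)
          ((((volume : Measure (Edge d L → ℝ)).withDensity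
                  fun p => ENNReal.ofReal (Real.exp (-(∑ i, p i ^ 2 / 2)))) Set.univ)⁻¹ •
              (volume : Measure (Edge d L → ℝ)).withDensity
                fun p => ENNReal.ofReal (Real.exp (-(∑ i, p i ^ 2 / 2)))))
        (layers.foldr (fun Ly (F : GaugeConfig d L Circle ≃ᵐ GaugeConfig d L Circle) => Ly.1.trans F) (MeasurableEquiv.refl (GaugeConfig d L Circle))))
      ({ toFun := fun V : GaugeConfig d L Circle => (fun e : Edge d L => V (e.1 + t, e.2)),
         invFun := fun V : GaugeConfig d L Circle => (fun e : Edge d L => V (e.1 - t, e.2)),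
         left_inv := fun V => funext fun e => by simp only [sub_add_cancel],
         right_inv := fun V => funext fun e => by simp only [add_sub_cancel_right],
         measurable_toFun := measurable_pi_lambda _ fun e => measurable_pi_apply _,
         measurable_invFun := measurable_pi_lambda _ fun e => measurable_pi_apply _ } : GaugeConfig d L Circle ≃ᵐ GaugeConfig d L Circle) =
      (conjKernel
        (refreshUpdate
          (involMH
            (⇑((flip : Equiv.Perm (GaugeConfig d L Circle × (Edge d L → ℝ))) *
                leapfrog (mulDrift (fun p : Edge d L → ℝ => fun i : Edge d L => Circle.exp (c * p i))) (fun V : GaugeConfig d L Circle => (fun i : Edge d L => κ * fderiv ℝ (fun p : (Edge d L → ℝ) => (fun W : GaugeConfig d L Circle => S ((layers.foldr (fun Ly (F : GaugeConfig d L Circle ≃ᵐ GaugeConfig d L Circle) => Ly.1.trans F) (MeasurableEquiv.refl (GaugeConfig d L Circle))) W) - Real.log ((layers.foldr (fun Ly K => fun v => Ly.2 v * K (Ly.1 v)) (fun _ => (1 : ℝ))) W)) ((fun i : Edge d L => Circle.exp (c * p i)) * V)) 0 (Pi.single i 1))) ^ n))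
            (measurable_flip_leapfrog_pow (measurable_mulDrift (measurable_circleDrift c)) (measurable_u1ExactForce hSc c κ) n)
            fun z : GaugeConfig d L Circle × (Edge d L → ℝ) =>
              (S ((layers.foldr (fun Ly (F : GaugeConfig d L Circle ≃ᵐ GaugeConfig d L Circle) => Ly.1.trans F) (MeasurableEquiv.refl (GaugeConfig d L Circle))) z.1) - Real.log ((layers.foldr (fun Ly K => fun v => Ly.2 v * K (Ly.1 v)) (fun _ => (1 : ℝ))) z.1)) + ∑ i, z.2 i ^ 2 / 2)
          ((((volume : Measure (Edge d L → ℝ)).withDensity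
                  fun p => ENNReal.ofReal (Real.exp (-(∑ i, p i ^ 2 / 2)))) Set.univ)⁻¹ •
              (volume : Measure (Edge d L → ℝ)).withDensity
                fun p => ENNReal.ofReal (Real.exp (-(∑ i, p i ^ 2 / 2)))))
        (layers.foldr (fun Ly (F : GaugeConfig d L Circle ≃ᵐ GaugeConfig d L Circle) => Ly.1.trans F) (MeasurableEquiv.refl (GaugeConfig d L Circle)))) := by
  obtain ⟨layers, hmap, -, hmeas, -⟩ := exists_layers_u1WilsonFlowLO χ hχ hε sched
  refine ⟨layers, hmap, ?_⟩
  intro t ht S hS hSi hSc c κ n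
  have hm := u1WilsonFlowLO_member_translate χ t ht ε sched layers hmap
  exact u1_fthmc_exactForce_conjKernel_translate t _ hm.1 (measurable_foldr_logDet layers hmeas) hm.2 hS hSi hSc c κ n

end Member

end Summit.Ventures.LatticeQCDFlow.Exactness
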